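import Summits.Ventures.PercRepro.C041TriangleMirror
import Summits.Ventures.PercRepro.C041StarBounds

/-!
# THE F-EXCESS FORM OF THE TRIANGLE — the cone conjecture for the triangle as one «room» inequality
(mine-3, gen 66; C-041.md §21 (bb))

`ℓψ w = T₁ • v 1 + T₂ • v 0 + σ • c + 2k • 1` with `c = 1 + e123 = (2,2,2,1,1,1)` and `σ = g − k` (`ellv_eq_marks`): a zone
hung by an edge is `T₁` one-marks, `T₂` two-marks, `σ` copies of the control point `c` of the leaf curve
(`v x = x² • v 1 + (1 − x)² • v 0 + x(1 − x) • c`) and `2k` constants.  Inserting this into the triangle identity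
gives (`thetaTri_eq_markPart`)
`θ_△(w, w′) = markPart w w′ + e123 * deficitZ w w′`,
where `markPart` is a MANIFEST cone element for `w, w′ ∈ cone` (`InCone_markPart`: products of `w`, `w′`, `v 1`, `v 0`, `1`
with the non-negative coefficients `T₁, T₂, σ, k, β`) and the deficit zone `deficitZ w w′ = σ • w′ + σ′ • w +
(2σ″ + α − β) • 1` is a cone element too (`InCone_deficitZ`; `α − β ≥ 0` because `T ≥ I` on the cone,
`I1_le_T1_of_InCone`).  Since `e123 * Z = ½ • (X(1,1) * Z) + (Z₀/2) • e_{L₀}` (`e123_mul_eq`), the WHOLE difficulty of the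
pure-star hypothesis `H` is the F-EXCESS `(Z₀/2) • e_{L₀}`, `e_{L₀} = (1,0,0,0,0,0)` (valid typeless states only):
`θ_△(w, w′) = markPart w w′ + ½ • (X(1,1) * deficitZ w w′) + fExcess w w′ • e_{L₀}` (`thetaTri_eq_FExcess`), and
`θ_△(w, w′) ∈ cone` as soon as the manifest part `markPart + ½ X(1,1) Z` has `e_{L₀}`-ROOM at least `fExcess`
(`InCone_thetaTri_of_room`).  The single-leaf cone `{T₁ • v 1 + T₂ • v 0 + σ • c : σ² ≤ T₁T₂}` has no such room
(it is flat); the room of the triangle's manifest part comes from the mixing of its product terms (C-041.md §21 (bb):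
numerically 2–5 × the excess).
-/

namespace PercRepro

namespace RelaxedTriangle

open TreeClosure

/-- `σ w = g − k = L₀ − (M₁ + M₂ − M₀)`: the valid-minus-invalid count of a zone. -/
def sigmaZ (w : Vec6) : ℝ := w 0 - kInv w

/-- `e_{L₀} = (1, 0, 0, 0, 0, 0)`: one valid typeless state. -/
def eL0 : Vec6 := ![1, 0, 0, 0, 0, 0]

/-- **The closure in mark coordinates**: `ℓψ w = T₁ • v 1 + T₂ • v 0 + σ • (1 + e123) + 2k • 1`. -/
theorem ellv_eq_marks (w : Vec6) :
    ellv w = T1 w • v 1 + T2 w • v 0 + sigmaZ w • ((1 : Vec6) + e123) + (2 * kInv w) • (1 : Vec6) := by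
  ext i
  simp only [Pi.add_apply, Pi.smul_apply, Pi.one_apply, smul_eq_mul]
  fin_cases i <;> simp [ellv, ell, T1, T2, sigmaZ, kInv, e123, v] <;> ring

/-- The leaf curve through its control point: `v x = x² • v 1 + (1 − x)² • v 0 + x(1 − x) • (1 + e123)`. -/
theorem v_eq_bernstein (x : ℝ) :
    v x = (x ^ 2) • v 1 + ((1 - x) ^ 2) • v 0 + (x * (1 - x)) • ((1 : Vec6) + e123) := by
  ext i
  simp only [Pi.add_apply, Pi.smul_apply, Pi.one_apply, smul_eq_mul]
  fin_cases i <;> simp [v, e123] <;> ring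

/-- The manifest cone part of the triangle. -/
def markPart (w w' : Vec6) : Vec6 :=
  T1 w • (v 1 * w') + T2 w • (v 0 * w') + T1 w' • (v 1 * w) + T2 w' • (v 0 * w)
    + (2 * T1 (w * w')) • v 1 + (2 * T2 (w * w')) • v 0
    + (2 * kInv w + sigmaZ w) • w' + (2 * kInv w' + sigmaZ w') • w
    + (4 * kInv (w * w') + 2 * sigmaZ (w * w') + (I1 w * I2 w' + I2 w * I1 w')) • (1 : Vec6)

/-- The deficit zone `Z = σ • w′ + σ′ • w + (2σ″ + α − β) • 1`. -/
def deficitZ (w w' : Vec6) : Vec6 :=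
  sigmaZ w • w' + sigmaZ w' • w
    + (2 * sigmaZ (w * w') + (T1 w * T2 w' + T2 w * T1 w') - (I1 w * I2 w' + I2 w * I1 w')) • (1 : Vec6)

/-- **THE MARK FORM OF THE TRIANGLE IDENTITY**: `θ_△(w, w′) = markPart w w′ + e123 * deficitZ w w′`. -/
theorem thetaTri_eq_markPart (w w' : Vec6) : thetaTri w w' = markPart w w' + e123 * deficitZ w w' := by
  ext i
  simp only [thetaTri_eq_vec, markPart, deficitZ, T1, T2, I1, I2, sigmaZ, kInv, e123, v, Pi.add_apply, Pi.smul_apply,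
    Pi.mul_apply, Pi.one_apply, smul_eq_mul]
  fin_cases i <;> simp <;> ring

/-- `e123 * Z = ½ • (X(1,1) * Z) + (Z₀ / 2) • e_{L₀}`. -/
theorem e123_mul_eq (Z : Vec6) : e123 * Z = (1 / 2 : ℝ) • (v 1 * v 0 * Z) + (Z 0 / 2) • eL0 := by
  ext i
  fin_cases i <;> simp [e123, eL0, v] <;> ring

/-- The F-excess of the triangle: `Z₀ / 2 = (σ L₀′ + σ′ L₀ + 2σ″ + α − β) / 2`. -/
noncomputable def fExcess (w w' : Vec6) : ℝ := deficitZ w w' 0 / 2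

/-- **THE F-EXCESS FORM**: `θ_△(w, w′) = markPart + ½ • (X(1,1) * Z) + fExcess • e_{L₀}`. -/
theorem thetaTri_eq_FExcess (w w' : Vec6) :
    thetaTri w w' = markPart w w' + (1 / 2 : ℝ) • (v 1 * v 0 * deficitZ w w') + fExcess w w' • eL0 := by
  rw [thetaTri_eq_markPart, e123_mul_eq, add_assoc]
  rfl

/-! ## The manifest parts are cone elements -/

/-- `k ≥ 0` on the cone. -/
theorem kInv_nonneg_of_InCone {w : Vec6} (hw : InCone w) : 0 ≤ kInv w := (K4v_of_InCone hw).k_nonneg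

/-- `σ = g − k ≥ 0` on the cone. -/
theorem sigmaZ_nonneg_of_InCone {w : Vec6} (hw : InCone w) : 0 ≤ sigmaZ w :=
  sub_nonneg.2 (K4v_of_InCone hw).k_le_g

/-- `T₁ ≥ 0` on the cone. -/
theorem T1_nonneg_of_InCone {w : Vec6} (hw : InCone w) : 0 ≤ T1 w := (K4v_of_InCone hw).t1_nonneg

/-- `T₂ ≥ 0` on the cone. -/
theorem T2_nonneg_of_InCone {w : Vec6} (hw : InCone w) : 0 ≤ T2 w := (K4v_of_InCone hw).t2_nonneg

/-- `I₁ ≥ 0` on the cone. -/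
theorem I1_nonneg_of_InCone {w : Vec6} (hw : InCone w) : 0 ≤ I1 w := by
  obtain ⟨_, h, _, _, _, _⟩ := InCone_coords hw
  unfold I1; linarith

/-- `I₂ ≥ 0` on the cone. -/
theorem I2_nonneg_of_InCone {w : Vec6} (hw : InCone w) : 0 ≤ I2 w := by
  obtain ⟨_, _, h, _, _, _⟩ := InCone_coords hw
  unfold I2; linarith

/-- **`T₁ ≥ I₁` on the cone** (the star bound `A(1 − B) ≤ P₁ − 1`, extended by linearity). -/
theorem I1_le_T1_of_InCone {w : Vec6} (hw : InCone w) : I1 w ≤ T1 w := by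
  induction hw with
  | pure a ha =>
    obtain ⟨h0, h1, h2, h3, h4, h5⟩ := TreeClosure.V_coords a
    have := prod_mul_one_sub_prod_le a ha
    unfold I1 T1
    rw [h0, h1, h3, h4]
    nlinarith
  | add _ _ ihx ihy =>
    unfold I1 T1 at *
    simp only [Pi.add_apply]
    linarith
  | smul c hc _ ih =>
    unfold I1 T1 at *
    simp only [Pi.smul_apply, smul_eq_mul]
    nlinarith

/-- **`T₂ ≥ I₂` on the cone** (the mirror). -/
theorem I2_le_T2_of_InCone {w : Vec6} (hw : InCone w) : I2 w ≤ T2 w := by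
  have h := I1_le_T1_of_InCone (InCone_sw hw)
  unfold I1 T1 at h
  unfold I2 T2
  simpa [sw] using h

/-- `α ≥ β` on the cone: `T₁T₂′ + T₂T₁′ ≥ I₁I₂′ + I₂I₁′`. -/
theorem beta_le_alpha_of_InCone {w w' : Vec6} (hw : InCone w) (hw' : InCone w') :
    I1 w * I2 w' + I2 w * I1 w' ≤ T1 w * T2 w' + T2 w * T1 w' := by
  have h1 := I1_le_T1_of_InCone hw; have h2 := I2_le_T2_of_InCone hw
  have h1' := I1_le_T1_of_InCone hw'; have h2' := I2_le_T2_of_InCone hw'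
  have := I1_nonneg_of_InCone hw; have := I2_nonneg_of_InCone hw
  have := I1_nonneg_of_InCone hw'; have := I2_nonneg_of_InCone hw'
  nlinarith [mul_le_mul h1 h2' (I2_nonneg_of_InCone hw') (T1_nonneg_of_InCone hw),
    mul_le_mul h2 h1' (I1_nonneg_of_InCone hw') (T2_nonneg_of_InCone hw)]

/-- **The manifest part is a cone element.** -/
theorem InCone_markPart {w w' : Vec6} (hw : InCone w) (hw' : InCone w') : InCone (markPart w w') := by
  have hww := hw.mul hw'
  have h1 := InCone_v1; have h0 := InCone_v0
  unfold markPart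
  refine ((((((((InCone.smul _ (T1_nonneg_of_InCone hw) (h1.mul hw')).add
    (InCone.smul _ (T2_nonneg_of_InCone hw) (h0.mul hw'))).add
    (InCone.smul _ (T1_nonneg_of_InCone hw') (h1.mul hw))).add
    (InCone.smul _ (T2_nonneg_of_InCone hw') (h0.mul hw))).add
    (InCone.smul _ (by linarith [T1_nonneg_of_InCone hww]) h1)).add
    (InCone.smul _ (by linarith [T2_nonneg_of_InCone hww]) h0)).add
    (InCone.smul _ (by linarith [kInv_nonneg_of_InCone hw, sigmaZ_nonneg_of_InCone hw]) hw')).add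
    (InCone.smul _ (by linarith [kInv_nonneg_of_InCone hw', sigmaZ_nonneg_of_InCone hw']) hw)).add
    (InCone.smul _ ?_ InCone_one)
  have := kInv_nonneg_of_InCone hww; have := sigmaZ_nonneg_of_InCone hww
  have := mul_nonneg (I1_nonneg_of_InCone hw) (I2_nonneg_of_InCone hw')
  have := mul_nonneg (I2_nonneg_of_InCone hw) (I1_nonneg_of_InCone hw')
  linarith

/-- **The deficit zone is a cone element.** -/
theorem InCone_deficitZ {w w' : Vec6} (hw : InCone w) (hw' : InCone w') : InCone (deficitZ w w') := by
  unfold deficitZ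
  refine ((InCone.smul _ (sigmaZ_nonneg_of_InCone hw) hw').add
    (InCone.smul _ (sigmaZ_nonneg_of_InCone hw') hw)).add (InCone.smul _ ?_ InCone_one)
  have := sigmaZ_nonneg_of_InCone (hw.mul hw')
  have := beta_le_alpha_of_InCone hw hw'
  linarith

/-- The F-excess is non-negative on the cone. -/
theorem fExcess_nonneg_of_InCone {w w' : Vec6} (hw : InCone w) (hw' : InCone w') : 0 ≤ fExcess w w' := by
  obtain ⟨_, _, _, _, _, h⟩ := InCone_coords (InCone_deficitZ hw hw')
  unfold fExcess; linarith

/-- **THE ROOM CRITERION**: if the manifest part `markPart + ½ X(1,1) Z` stays in the cone after adding `ε • e_{L₀}`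
for some `ε ≥ fExcess`, the triangle's six-vector is in the cone. -/
theorem InCone_thetaTri_of_room {w w' : Vec6} (hw : InCone w) (hw' : InCone w') {ε : ℝ} (hε : fExcess w w' ≤ ε)
    (h : InCone (markPart w w' + (1 / 2 : ℝ) • (v 1 * v 0 * deficitZ w w') + ε • eL0)) :
    InCone (thetaTri w w') := by
  have hYc : InCone (markPart w w' + (1 / 2 : ℝ) • (v 1 * v 0 * deficitZ w w')) :=
    (InCone_markPart hw hw').add (InCone.smul _ (by norm_num) ((InCone_v1.mul InCone_v0).mul (InCone_deficitZ hw hw')))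
  have hf := fExcess_nonneg_of_InCone hw hw'
  rw [thetaTri_eq_FExcess]
  generalize hY : markPart w w' + (1 / 2 : ℝ) • (v 1 * v 0 * deficitZ w w') = Y at h hYc ⊢
  generalize hd : fExcess w w' = d at hf hε ⊢
  rcases eq_or_lt_of_le (le_trans hf hε) with h0 | hpos
  · have : d = 0 := by linarith
    rw [this, zero_smul, add_zero]
    exact hYc
  · have hε0 : ε ≠ 0 := ne_of_gt hpos
    have e : Y + d • eL0 = (1 - d / ε) • Y + (d / ε) • (Y + ε • eL0) := by
      rw [smul_add, smul_smul, div_mul_cancel₀ _ hε0, sub_smul, one_smul]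
      abel
    rw [e]
    refine (InCone.smul _ ?_ hYc).add (InCone.smul _ (div_nonneg hf hpos.le) h)
    rw [sub_nonneg, div_le_one hpos]
    exact hε

end RelaxedTriangle

end PercRepro
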